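import Summits.QuantumFields.YangMills.Theorems.BalabanLadderIRStubRungStrong

/-!
# `IR` — stub `stub_shellRung` of line L2′ «shell-tempered» PROVED (by-name discharge module)

Spine route `BalabanLadder` (route-QuantumFields-BalabanLadder), crux `IR` (stmt-QuantumFields-19354), registered BC3 skeleton
v4 `IR_birth_shell_v4.lean` (ym-beyond P2 g17, sha16 af5e01d9b33f9db7; namespace `…Cruxes.IR.ShellTempered`), stub 4 = the BC5
rung `stub_shellRung`:

  for every compact group `G`, every continuous matrix representation `ρ`, every `ε > 0` there is `β_D > 0` such that for
  `|β| ≤ β_D` and every `δ ≥ 0` the SHELL-TEMPERED finite-size condition holds at cell side 1, window 1.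

This module states that conclusion with `ShellTemperedCond ρ β 1 1 ε δ` UNFOLDED (the skeleton's `def` is not a tree constant; the
skeleton discharges its stub from this theorem by `exact`, definitional unfolding only) and proves it from the landed helper
`Summit.QuantumFields.YangMills.Cruxes.IR.Tempered.stub_rung_strong_proved` (`Theorems/BalabanLadderIRStubRungStrong.lean`):
take the v2 statement at the FULL window `Y = windowCells 1`; its rarity clause at the empty collar (`E' = ∅`, the Dirac kernel —
`ymSpecification_empty`) forces the v2 class to be everything (WINDOW DEGENERACY, the owner's erratum IR-LINE-L2-ERRATUM-g17); glue
`σ'` inside the window into `σ` (the window kernel does not read its own region — `ymSpecification_congr_off`) to drop the agreement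
hypothesis; take `T = univ` (clause (ii) is then trivial for every `δ ≥ 0`).

Geometry reused from the helper module (`Tempered.cellEdges/windowCells/regionEdges/collarEdges`); new here: `windowCellsPlus`,
`shellEdges` (the one-cell shell outside the window, where the v4 tempered class lives).
-/

set_option autoImplicit false

noncomputable section

open MeasureTheory
open Literature.MathematicalPhysics.QuantumFieldTheory Literature.MathematicalPhysics.QuantumLattice
open Literature.Probability.LatticeModels
open Summit.QuantumFields.YangMills.Cruxes.IR.Tempered (cellEdges windowCells regionEdges collarEdges)

namespace Summit.QuantumFields.YangMills.Cruxes.IR.ShellTempered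

/-! ## §1 The shell -/

/-- The window enlarged by one layer of cells (radius `2n + 1`). -/
def windowCellsPlus (n : ℕ) : Finset (Fin 4 → ℤ) :=
  Fintype.piFinset fun _ : Fin 4 => Finset.Icc (-(2 * ((n : ℕ) : ℤ) + 1)) (2 * ((n : ℕ) : ℤ) + 1)

/-- The SHELL: edges of the one-cell layer outside the window (it contains every edge the window kernel reads). -/
def shellEdges (w : Fin 4 → ℤ → ℤ) (n : ℕ) : Finset (Literature.MathematicalPhysics.QuantumLattice.ZdEdge 4) :=
  regionEdges w (windowCellsPlus n) \ regionEdges w (windowCells n)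

/-! ## §2 Two kernel facts: the empty region, and congruence off the region -/

section Kernel

variable {N : ℕ} {G : Type} [Group G] [TopologicalSpace G] [IsTopologicalGroup G] [CompactSpace G]
  [MeasurableSpace G] [BorelSpace G] (ρ : G →* Matrix (Fin N) (Fin N) ℂ)

/-- No plaquette touches the empty edge set. [folklore] -/
theorem plaquettesTouching_empty :
    plaquettesTouching (d := 4) (∅ : Finset (Literature.MathematicalPhysics.QuantumLattice.ZdEdge 4)) = ∅ := by
  ext p
  simp [mem_plaquettesTouching_iff]

omit [TopologicalSpace G] [IsTopologicalGroup G] [CompactSpace G] [MeasurableSpace G] [BorelSpace G] in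
/-- The boundary Wilson action of the empty region vanishes. [folklore] -/
theorem wilsonBoundaryAction_empty (U : LGConfig 4 G) :
    wilsonBoundaryAction (G := G) ρ (∅ : Finset (Literature.MathematicalPhysics.QuantumLattice.ZdEdge 4)) U = 0 := by
  unfold wilsonBoundaryAction
  rw [plaquettesTouching_empty, Finset.sum_empty]

/-- **The Wilson DLR kernel of the EMPTY region is the Dirac mass at the exterior datum.** [folklore] -/
theorem ymSpecification_empty (β : ℝ) (ζ : LGConfig 4 G) :
    ymSpecification (G := G) ρ β (∅ : Finset (Literature.MathematicalPhysics.QuantumLattice.ZdEdge 4)) ζ =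
      Measure.dirac ζ := by
  have hglue : (fun x : (↥(∅ : Finset (Literature.MathematicalPhysics.QuantumLattice.ZdEdge 4)) → G) =>
      glueWith ∅ x ζ) = fun _ => ζ := by
    funext x
    funext e
    simp [glueWith]
  have hS : (fun U : LGConfig 4 G =>
      -β * wilsonBoundaryAction (G := G) ρ (∅ : Finset (Literature.MathematicalPhysics.QuantumLattice.ZdEdge 4)) U) =
      fun _ => 0 := by
    funext U
    rw [wilsonBoundaryAction_empty, mul_zero]
  unfold ymSpecification
  rw [hglue, hS, Measure.map_const, measure_univ, one_smul]
  exact tilted_const _ _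

/-- **Kernel congruence**: the Wilson DLR kernel of region `Λ` depends on the exterior datum only OFF `Λ`. [folklore] -/
theorem ymSpecification_congr_off (β : ℝ) (Λ : Finset (Literature.MathematicalPhysics.QuantumLattice.ZdEdge 4))
    {η η' : LGConfig 4 G} (h : ∀ e ∉ Λ, η e = η' e) :
    ymSpecification (G := G) ρ β Λ η = ymSpecification (G := G) ρ β Λ η' := by
  have hg : (fun x : (↥Λ → G) => glueWith Λ x η) = fun x => glueWith Λ x η' := by
    funext x
    funext e
    by_cases he : e ∈ Λ
    · simp [glueWith, he]
    · simp [glueWith, he, h e he]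
  unfold ymSpecification
  rw [hg]

end Kernel

/-! ## §3 The stub, proved -/

/-- **`stub_shellRung` (BC5 rung of crux `IR`, line L2′), PROVED**: deep in the strong-coupling window the shell-tempered
finite-size condition holds at cell side 1, window 1, every threshold `ε > 0`, every rarity budget `δ ≥ 0`, with the trivial
tempered class `T = univ`.  The conclusion is `ShellTemperedCond ρ β 1 1 ε δ` of the registered skeleton, unfolded. -/
theorem stub_shellRung_proved :
    ∀ (G : Type) [Group G] [TopologicalSpace G] [IsTopologicalGroup G] [CompactSpace G]
      [MeasurableSpace G] [BorelSpace G] (N : ℕ) (ρ : G →* Matrix (Fin N) (Fin N) ℂ), Continuous ρ →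
      ∀ ε : ℝ, 0 < ε → ∃ β_D : ℝ, 0 < β_D ∧ ∀ β : ℝ, |β| ≤ β_D → ∀ δ : ℝ, 0 ≤ δ →
        ∀ w : Fin 4 → ℤ → ℤ,
          (∀ i j, w i j + ((1 : ℕ) : ℤ) ≤ w i (j + 1) ∧ w i (j + 1) ≤ w i j + 2 * ((1 : ℕ) : ℤ)) →
          ∃ T : Set (LGConfig 4 G), MeasurableSet T ∧ DependsOn (fun σ : LGConfig 4 G => σ ∈ T) ↑(shellEdges w 1) ∧
            (∀ σ σ' : LGConfig 4 G, σ ∈ T → σ' ∈ T →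
              ∀ f : LGConfig 4 G → ℝ, IsCylinder f (cellEdges w 0) → Measurable f → (∀ U, 0 ≤ f U ∧ f U ≤ 1) →
                |(∫ U, f U ∂(ymSpecification ρ β (regionEdges w (windowCells 1)) σ)) -
                  ∫ U, f U ∂(ymSpecification ρ β (regionEdges w (windowCells 1)) σ')| ≤ ε) ∧
            (∀ E' : Finset (Literature.MathematicalPhysics.QuantumLattice.ZdEdge 4),
              regionEdges w (windowCellsPlus 1) ⊆ E' →
              ∀ ζ : LGConfig 4 G, (ymSpecification ρ β E' ζ) Tᶜ ≤ ENNReal.ofReal δ) := by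
  intro G _ _ _ _ _ _ N ρ hρ ε hε
  obtain ⟨β_D, hβD, H⟩ := Summit.QuantumFields.YangMills.Cruxes.IR.Tempered.stub_rung_strong_proved G N ρ hρ ε hε
  refine ⟨β_D, hβD, fun β hβ δ _ w hw => ?_⟩
  -- the v2 rung at the FULL window `Y = windowCells 1`
  have h0 : (0 : Fin 4 → ℤ) ∈ windowCells 1 := by
    simp [Summit.QuantumFields.YangMills.Cruxes.IR.Tempered.windowCells, Fintype.mem_piFinset]
  obtain ⟨T, _, hmix, hrare⟩ := H β hβ w hw (windowCells 1) subset_rfl h0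
  -- WINDOW DEGENERACY: the collar of the full window is empty, the empty kernel is a Dirac mass, so the v2 class is everything
  have hcollar : collarEdges w 1 (windowCells 1) = ∅ := by
    simp [Summit.QuantumFields.YangMills.Cruxes.IR.Tempered.collarEdges]
  have huniv : ∀ ζ : LGConfig 4 G, ζ ∈ T := by
    intro ζ
    by_contra hζ
    have h := hrare ∅ (by rw [hcollar]) ζ
    rw [ymSpecification_empty, Measure.dirac_apply_of_mem (show ζ ∈ Tᶜ from hζ), ENNReal.ofReal_zero] at h
    exact absurd h (not_le.2 one_pos)
  refine ⟨Set.univ, MeasurableSet.univ, ?_, ?_, ?_⟩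
  · intro x y _
    rfl
  · intro σ σ' _ _ f hf hfm hf01
    -- KERNEL CONGRUENCE: glue `σ'` inside the window into `σ`
    classical
    let σt : LGConfig 4 G := fun e => if e ∈ regionEdges w (windowCells 1) then σ' e else σ e
    have hoff : ∀ e ∉ regionEdges w (windowCells 1), σ e = σt e := by
      intro e he
      simp [σt, he]
    have hagree : ∀ e ∈ regionEdges w (windowCells 1), σt e = σ' e := by
      intro e he
      simp [σt, he]
    rw [ymSpecification_congr_off ρ β (regionEdges w (windowCells 1)) hoff]
    exact hmix σt σ' (huniv _) (huniv _) hagree f hf hfm hf01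
  · intro E' _ ζ
    simp only [Set.compl_univ, measure_empty, zero_le]

end Summit.QuantumFields.YangMills.Cruxes.IR.ShellTempered

end
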